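import Summits.RiemannHypothesis.RiemannHypothesis.Theorems.GroundBartaPolarPerronFrobeniusTruncatedBarrier
import Summits.RiemannHypothesis.RiemannHypothesis.Theorems.GroundBartaPolarPerronFrobeniusTruncatedRobustGap
import Summits.RiemannHypothesis.RiemannHypothesis.Theorems.WeilGroundStateGroundStatesConvergeToXiWeightedL1
import Literature.NumberTheory.LFunctions.WeilArchimedeanPositivityProofs
import HarnessLib

/-!
# RiemannHypothesis / GroundBarta — cruxes `PolarPerronFrobenius` (stmt-RiemannHypothesis-18390) and
# `EvenSectorBarta.EvenOneSignedWindows` (stmt-RiemannHypothesis-19953):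
# the PRIME-TRUNCATION BARRIER, part 4b — NO finite-prime truncation has a one-signed bottom state at any
# large window; the cruxes are FALSE for every `E_N`

Helper file (`--supports`), RH-free, Mathlib + proved tree files only, no definitions.

The cruxes ask (cofinally in the window `a`) for a BOTTOM STATE — an `L²` limit `u` of an `L²`-normalised
minimising sequence of window tests (all tests: `GSP a` of 18390; even tests: 19953) — that is real and `≥ 0`
a.e. on `(−a, a)`.  For every finite-prime truncation `E_N` of Weil's form
(`Literature.NumberTheory.LFunctions.weilFinitePrimeQuadratic`; `N ≤ 1`: Yoshida's prime-free `weilArchQuadratic`)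
this is IMPOSSIBLE at every window `a ≥ a₀(N)`:
* `pt_truncated_no_oneSigned_bottom` — no one-signed bottom state of `E_N` over all window tests;
* `pt_truncated_no_oneSigned_evenBottom` — none over the even window tests;
* `pt_not_cofinalGSP_trunc`, `pt_not_evenOneSignedWindows_trunc` — hence the statements "cofinally some window
  carries a one-signed bottom state" (the `EW`-free content of 18390, and 19953 verbatim) with `Re Q ↦ E_N`
  are FALSE, for every `N`.
Mechanism: along a minimising sequence `gₙ → u` in `L²` with `u` one-signed on the window, the `L¹` defect
`η(gₙ) = ∫((Re gₙ)⁻ + |Im gₙ|) ≤ 2∫_{[−a,a]}|gₙ − u| ≤ 2√(2a)‖gₙ − u‖₂ → 0`, so the ROBUST CONE GAP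
(`pt_robust_cone_gap`) forces `lim E_N(gₙ) ≥ F_N`, whereas the spread witness of the barrier
(`pt_truncated_barrier`) has energy `≤ F_N − 2` — the sequence was not minimising.  No form-domain theory,
no Euler–Lagrange equation, no existence of bottom states is used.  In contrast, for the TRUE form the tree
proves `GSP a` at every `0 < a ≤ 11/40` (`et_exists_even_real_nonneg_isWeilGroundState`), where `Re Q = E`.
Prover B, speedrun unit `sr-gb-rung-b` (rung 3).

References: H. Yoshida, Adv. Stud. Pure Math. 21 (1992) §2, §6; E. Bombieri, Rend. Lincei (9) 11 (2000) §4;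
A. Connes, C. Consani, arXiv:2106.01715 §2.2–2.4 (numerical sensitivity of truncated forms to the primes).
-/

set_option linter.dupNamespace false

noncomputable section

open Set MeasureTheory Filter Complex
open scoped Real Topology ComplexConjugate

namespace Summit.RiemannHypothesis.RiemannHypothesis.Theorems.PolarPerronFrobenius

open Literature.NumberTheory.LFunctions Literature.Analysis.SpecialFunctions
open Summit.RiemannHypothesis.RiemannHypothesis.Theorems.GroundStatesConvergeToXi (weightedL1_integral_norm_le_sqrt)

/-! ## The core: a one-signed `L²` limit cannot undercut the cone floor -/

/-- **Core lemma.** If `L²`-normalised window tests `gₙ` (on `[−a, a]`) converge in `L²` to a function `u`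
that is real and `≥ 0` a.e. on `(−a, a)`, and eventually `E_N(gₙ) ≤ E_N(h₀) + δ` for every `δ > 0` for some
fixed test `h₀` with `E_N(h₀) ≤ F_N − 2`, contradiction. [cite: Yoshida1992, §2 eq. (2.1), §6] -/
theorem pt_no_oneSigned_limit_core {N : ℕ} {a : ℝ} {h₀ u : ℝ → ℂ} {g : ℕ → ℝ → ℂ}
    (hh₀ : weilFinitePrimeQuadratic N h₀ ≤ reDigammaQuarter 0 - Real.log π + 24 / 5 -
        2 * (∑ n ∈ Finset.range (N + 1), (ArithmeticFunction.vonMangoldt n : ℝ) / Real.sqrt n) - 2)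
    (hg : ∀ n, IsWeilTest (g n) ∧ tsupport (g n) ⊆ Icc (-a) a ∧ ∫ t, ‖g n t‖ ^ 2 = (1 : ℝ))
    (hmin : ∀ δ : ℝ, 0 < δ → ∀ᶠ n in atTop, weilFinitePrimeQuadratic N (g n) ≤ weilFinitePrimeQuadratic N h₀ + δ)
    (hu : MemLp u 2) (hL : Tendsto (fun n ↦ ∫ t, ‖g n t - u t‖ ^ 2) atTop (𝓝 0))
    (hsign : ∀ᵐ t : ℝ, t ∈ Ioo (-a) a → (u t).im = 0 ∧ 0 ≤ (u t).re) : False := by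
  set F := reDigammaQuarter 0 - Real.log π + 24 / 5 -
    2 * (∑ n ∈ Finset.range (N + 1), (ArithmeticFunction.vonMangoldt n : ℝ) / Real.sqrt n) with hF
  -- the Cauchy–Schwarz constant of the window
  set K : ℝ := (∫ t, ‖(Icc (-a) a).indicator (fun _ ↦ (1 : ℂ)) t‖ ^ (2 : ℝ)) ^ (1 / (2 : ℝ)) with hK
  have hK0 : 0 ≤ K := Real.rpow_nonneg (integral_nonneg fun t ↦ by positivity) _
  set C := 8 * (Real.exp a + 1) with hC
  have hC0 : 0 ≤ C := by positivity
  -- choose the accuracy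
  set ε : ℝ := 1 / (2 * C * K ^ 2 + 1) with hε
  have hε0 : 0 < ε := by positivity
  have hεC : 2 * C * K ^ 2 * ε ≤ 1 := by
    rw [hε, mul_one_div, div_le_one (by positivity)]; linarith
  -- bookkeeping for the sequence
  have hg0 : ∀ n t, t ∉ Icc (-a) a → g n t = 0 := fun n t ht ↦
    image_eq_zero_of_notMem_tsupport fun h' ↦ ht ((hg n).2.1 h')
  have hg0' : ∀ n t, t ∉ Ioo (-a) a → g n t = 0 := fun n t ht ↦ by
    by_contra h
    exact ht (support_subset_Ioo_of_tsupport_subset_Icc (hg n).1.1.continuous (hg n).2.1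
      (Function.mem_support.2 h))
  have hgm : ∀ n, MemLp (g n) 2 := fun n ↦ (hg n).1.1.continuous.memLp_of_hasCompactSupport (hg n).1.2
  have hp_le : ∀ n, ∫ x, ‖g n x‖ ≤ K := fun n ↦ by
    have h := weightedL1_integral_norm_le_sqrt (a := a) (hgm n) (ae_of_all _ (hg0 n))
    rwa [(hg n).2.2, Real.sqrt_one, one_mul] at h
  -- the truncated differences
  haveI : IsFiniteMeasure (volume.restrict (Icc (-a) a)) :=
    isFiniteMeasure_restrict.2 measure_Icc_lt_top.ne
  set v : ℕ → ℝ → ℂ := fun n ↦ (Icc (-a) a).indicator fun t ↦ g n t - u t with hv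
  have hvm : ∀ n, MemLp (v n) 2 := fun n ↦ ((hgm n).sub hu).indicator measurableSet_Icc
  have hv0 : ∀ n, ∀ᵐ t : ℝ, t ∉ Icc (-a) a → v n t = 0 := fun n ↦
    ae_of_all _ fun t ht ↦ by simp [hv, ht]
  have hvi : ∀ n, Integrable (v n) := fun n ↦ by
    have h1 : IntegrableOn (fun t ↦ g n t - u t) (Icc (-a) a) :=
      (((hg n).1.1.continuous.integrable_of_hasCompactSupport (hg n).1.2).integrableOn).sub
        ((hu.restrict (Icc (-a) a)).integrable one_le_two)
    exact h1.integrable_indicator measurableSet_Icc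
  have hv2 : ∀ n, ∫ t, ‖v n t‖ ^ 2 ≤ ∫ t, ‖g n t - u t‖ ^ 2 := fun n ↦
    integral_mono ((memLp_two_iff_integrable_sq_norm (hvm n).1).1 (hvm n))
      ((memLp_two_iff_integrable_sq_norm ((hgm n).sub hu).1).1 ((hgm n).sub hu))
      fun t ↦ pow_le_pow_left₀ (norm_nonneg _) (norm_indicator_le_norm_self _ _) 2
  -- the defect is controlled by the truncated difference
  have hη_le : ∀ n, ∫ t, (max (-(g n t).re) 0 + |(g n t).im|) ≤ 2 * ∫ t, ‖v n t‖ := fun n ↦ by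
    rw [← integral_const_mul]
    have hi1 : Integrable fun t ↦ max (-(g n t).re) 0 + |(g n t).im| := by
      have huc : Continuous fun t ↦ (g n t).re := Complex.continuous_re.comp (hg n).1.1.continuous
      have hus : HasCompactSupport fun t ↦ (g n t).re := (hg n).1.2.comp_left (g := Complex.re) Complex.zero_re
      have hvc : Continuous fun t ↦ (g n t).im := Complex.continuous_im.comp (hg n).1.1.continuous
      have hvs : HasCompactSupport fun t ↦ (g n t).im := (hg n).1.2.comp_left (g := Complex.im) Complex.zero_im
      exact (sw_integrable_posPart (f := fun t ↦ -(g n t).re) huc.neg hus.neg).add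
        (hvc.abs.integrable_of_hasCompactSupport hvs.abs)
    refine integral_mono_ae hi1 ((hvi n).norm.const_mul 2) ?_
    filter_upwards [hsign] with t ht
    by_cases hmem : t ∈ Ioo (-a) a
    · obtain ⟨him, hre⟩ := ht hmem
      have hvt : v n t = g n t - u t := by simp [hv, Ioo_subset_Icc_self hmem]
      rw [hvt]
      have h1 : max (-(g n t).re) 0 ≤ ‖g n t - u t‖ := by
        refine max_le ?_ (norm_nonneg _)
        have := Complex.re_le_norm (u t - g n t)
        rw [Complex.sub_re, ← norm_neg, neg_sub] at this
        linarith
      have h2 : |(g n t).im| ≤ ‖g n t - u t‖ := by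
        have := Complex.abs_im_le_norm (g n t - u t)
        rwa [Complex.sub_im, him, sub_zero] at this
      linarith
    · rw [hg0' n t hmem]
      simp only [Complex.zero_re, neg_zero, max_self, Complex.zero_im, abs_zero, add_zero]
      positivity
  -- pick an index where both the minimising inequality and the L² proximity hold
  have hev1 : ∀ᶠ n in atTop, weilFinitePrimeQuadratic N (g n) ≤ weilFinitePrimeQuadratic N h₀ + 1 / 2 :=
    hmin (1 / 2) (by norm_num)
  have hev2 : ∀ᶠ n in atTop, ∫ t, ‖g n t - u t‖ ^ 2 < ε ^ 2 :=
    (tendsto_order.1 hL).2 _ (by positivity)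
  obtain ⟨n, hn1, hn2⟩ := (hev1.and hev2).exists
  -- the robust gap at that index
  have hgap := pt_robust_cone_gap N (hg n).1 (hg n).2.1
  rw [show weilNorm2Sq (g n) = 1 from (hg n).2.2, mul_one] at hgap
  have hsqrt : Real.sqrt (∫ t, ‖v n t‖ ^ 2) < ε :=
    (Real.sqrt_lt' hε0).2 (lt_of_le_of_lt (hv2 n) hn2)
  have hvL1 : ∫ t, ‖v n t‖ ≤ Real.sqrt (∫ t, ‖v n t‖ ^ 2) * K :=
    weightedL1_integral_norm_le_sqrt (hvm n) (hv0 n)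
  have hη : ∫ t, (max (-(g n t).re) 0 + |(g n t).im|) ≤ 2 * (ε * K) := by
    have := hη_le n
    nlinarith [mul_le_mul_of_nonneg_right hsqrt.le hK0]
  have hηnn : 0 ≤ ∫ t, (max (-(g n t).re) 0 + |(g n t).im|) :=
    integral_nonneg fun t ↦ add_nonneg (le_max_right _ _) (abs_nonneg _)
  have hpnn : 0 ≤ ∫ x, ‖g n x‖ := integral_nonneg fun x ↦ norm_nonneg _
  have hprod : C * (∫ x, ‖g n x‖) * (∫ t, (max (-(g n t).re) 0 + |(g n t).im|)) ≤ C * K * (2 * (ε * K)) := by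
    have := mul_le_mul (mul_le_mul_of_nonneg_left (hp_le n) hC0) hη hηnn (by positivity)
    linarith
  have : F - 1 ≤ weilFinitePrimeQuadratic N (g n) := by
    have h2 : C * K * (2 * (ε * K)) = 2 * C * K ^ 2 * ε := by ring
    linarith
  linarith

/-! ## No one-signed bottom states for any truncation at large windows -/

/-- **No one-signed bottom state of `E_N` (all window tests) at any window `a ≥ a₀(N)`** — the negation of
`GSP a` with `Re Q ↦ E_N`. [cite: Yoshida1992, §2 eq. (2.1), §6] -/
theorem pt_truncated_no_oneSigned_bottom (N : ℕ) :
    ∃ a₀ : ℝ, 1 ≤ a₀ ∧ ∀ a : ℝ, a₀ ≤ a →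
      ¬ ∃ u : ℝ → ℂ, (MemLp u 2 ∧ ∃ g : ℕ → ℝ → ℂ,
          (∀ n, IsWeilTest (g n) ∧ tsupport (g n) ⊆ Icc (-a) a ∧ ∫ t, ‖g n t‖ ^ 2 = (1 : ℝ)) ∧
          (∀ h : ℝ → ℂ, IsWeilTest h → tsupport h ⊆ Icc (-a) a → ∫ t, ‖h t‖ ^ 2 = (1 : ℝ) →
            ∀ δ : ℝ, 0 < δ → ∀ᶠ n in atTop,
              weilFinitePrimeQuadratic N (g n) ≤ weilFinitePrimeQuadratic N h + δ) ∧
          Tendsto (fun n ↦ ∫ t, ‖g n t - u t‖ ^ 2) atTop (𝓝 0)) ∧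
        (∀ᵐ t : ℝ, t ∈ Ioo (-a) a → (u t).im = 0 ∧ 0 ≤ (u t).re) := by
  obtain ⟨a₀, ha₀, hbar⟩ := pt_truncated_barrier N
  refine ⟨a₀, ha₀, fun a ha ↦ ?_⟩
  rintro ⟨u, ⟨hu, g, hg, hmin, hL⟩, hsign⟩
  obtain ⟨h₀, hh₀, hsupp₀, -, -, -, -, hnorm₀, hE₀, -⟩ := hbar a ha
  exact pt_no_oneSigned_limit_core (by linarith) hg (hmin h₀ hh₀ hsupp₀ hnorm₀) hu hL hsign

/-- **No one-signed EVEN-SECTOR bottom state of `E_N` at any window `a ≥ a₀(N)`** — the negation of the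
window clause of `EvenOneSignedWindows` (19953) with `Re Q ↦ E_N`. [cite: Yoshida1992, §2 eq. (2.1), §6] -/
theorem pt_truncated_no_oneSigned_evenBottom (N : ℕ) :
    ∃ a₀ : ℝ, 1 ≤ a₀ ∧ ∀ a : ℝ, a₀ ≤ a →
      ¬ ∃ u : ℝ → ℂ, (MemLp u 2 ∧ ∃ g : ℕ → ℝ → ℂ,
          (∀ n, IsWeilTest (g n) ∧ tsupport (g n) ⊆ Icc (-a) a ∧ (∀ t, g n (-t) = g n t) ∧
            ∫ t, ‖g n t‖ ^ 2 = (1 : ℝ)) ∧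
          (∀ h : ℝ → ℂ, IsWeilTest h → tsupport h ⊆ Icc (-a) a → (∀ t, h (-t) = h t) →
            ∫ t, ‖h t‖ ^ 2 = (1 : ℝ) → ∀ δ : ℝ, 0 < δ → ∀ᶠ n in atTop,
              weilFinitePrimeQuadratic N (g n) ≤ weilFinitePrimeQuadratic N h + δ) ∧
          Tendsto (fun n ↦ ∫ t, ‖g n t - u t‖ ^ 2) atTop (𝓝 0)) ∧
        (∀ᵐ t : ℝ, t ∈ Ioo (-a) a → (u t).im = 0 ∧ 0 ≤ (u t).re) := by
  obtain ⟨a₀, ha₀, hbar⟩ := pt_truncated_barrier N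
  refine ⟨a₀, ha₀, fun a ha ↦ ?_⟩
  rintro ⟨u, ⟨hu, g, hg, hmin, hL⟩, hsign⟩
  obtain ⟨h₀, hh₀, hsupp₀, heven₀, -, -, -, hnorm₀, hE₀, -⟩ := hbar a ha
  exact pt_no_oneSigned_limit_core (by linarith) (fun n ↦ ⟨(hg n).1, (hg n).2.1, (hg n).2.2.2⟩)
    (hmin h₀ hh₀ hsupp₀ heven₀ hnorm₀) hu hL hsign

/-- **`EvenOneSignedWindows` (crux 19953 of EvenSectorBarta) is FALSE for every finite-prime truncation**:
with `Re Q ↦ E_N` it is not true that beyond every height some window carries a one-signed even-sector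
bottom state. [cite: Yoshida1992, §2 eq. (2.1), §6] -/
theorem pt_not_evenOneSignedWindows_trunc (N : ℕ) :
    ¬ ∀ A : ℝ, ∃ a : ℝ, A ≤ a ∧ ∃ u : ℝ → ℂ, (MemLp u 2 ∧ ∃ g : ℕ → ℝ → ℂ,
          (∀ n, IsWeilTest (g n) ∧ tsupport (g n) ⊆ Icc (-a) a ∧ (∀ t, g n (-t) = g n t) ∧
            ∫ t, ‖g n t‖ ^ 2 = (1 : ℝ)) ∧
          (∀ h : ℝ → ℂ, IsWeilTest h → tsupport h ⊆ Icc (-a) a → (∀ t, h (-t) = h t) →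
            ∫ t, ‖h t‖ ^ 2 = (1 : ℝ) → ∀ δ : ℝ, 0 < δ → ∀ᶠ n in atTop,
              weilFinitePrimeQuadratic N (g n) ≤ weilFinitePrimeQuadratic N h + δ) ∧
          Tendsto (fun n ↦ ∫ t, ‖g n t - u t‖ ^ 2) atTop (𝓝 0)) ∧
        (∀ᵐ t : ℝ, t ∈ Ioo (-a) a → (u t).im = 0 ∧ 0 ≤ (u t).re) := by
  obtain ⟨a₀, -, hno⟩ := pt_truncated_no_oneSigned_evenBottom N
  intro h
  obtain ⟨a, ha, hex⟩ := h a₀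
  exact hno a ha hex

/-- **Cofinal `GSP` (the `EW`-free content of crux 18390) is FALSE for every finite-prime truncation**: with
`Re Q ↦ E_N` it is not true that beyond every height some window carries a one-signed bottom state. [cite: Yoshida1992, §2 eq. (2.1), §6] -/
theorem pt_not_cofinalGSP_trunc (N : ℕ) :
    ¬ ∀ A : ℝ, ∃ a : ℝ, A ≤ a ∧ ∃ u : ℝ → ℂ, (MemLp u 2 ∧ ∃ g : ℕ → ℝ → ℂ,
          (∀ n, IsWeilTest (g n) ∧ tsupport (g n) ⊆ Icc (-a) a ∧ ∫ t, ‖g n t‖ ^ 2 = (1 : ℝ)) ∧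
          (∀ h : ℝ → ℂ, IsWeilTest h → tsupport h ⊆ Icc (-a) a → ∫ t, ‖h t‖ ^ 2 = (1 : ℝ) →
            ∀ δ : ℝ, 0 < δ → ∀ᶠ n in atTop,
              weilFinitePrimeQuadratic N (g n) ≤ weilFinitePrimeQuadratic N h + δ) ∧
          Tendsto (fun n ↦ ∫ t, ‖g n t - u t‖ ^ 2) atTop (𝓝 0)) ∧
        (∀ᵐ t : ℝ, t ∈ Ioo (-a) a → (u t).im = 0 ∧ 0 ≤ (u t).re) := by
  obtain ⟨a₀, -, hno⟩ := pt_truncated_no_oneSigned_bottom N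
  intro h
  obtain ⟨a, ha, hex⟩ := h a₀
  exact hno a ha hex

/-- Prime-free specialisation (`N ≤ 1`, `E = weilArchQuadratic`):
`E(g) ≥ (ψ(1/4) − log π + 24/5)‖g‖₂² − 8(e^a + 1)‖g‖₁ η(g)`. [cite: Yoshida1992, §2 eq. (2.1), §6] -/
theorem pt_robust_cone_gap_weilArchQuadratic {g : ℝ → ℂ} {a : ℝ} (hg : IsWeilTest g)
    (hsupp : tsupport g ⊆ Icc (-a) a) :
    (reDigammaQuarter 0 - Real.log π + 24 / 5) * weilNorm2Sq g -
      8 * (Real.exp a + 1) * (∫ x : ℝ, ‖g x‖) * (∫ t : ℝ, (max (-(g t).re) 0 + |(g t).im|)) ≤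
      weilArchQuadratic g := by
  have h := pt_robust_cone_gap 1 hg hsupp
  rw [pt_weilFinitePrimeQuadratic_eq_weilArchQuadratic le_rfl] at h
  have h0 : ∑ n ∈ Finset.range (1 + 1), (ArithmeticFunction.vonMangoldt n : ℝ) / Real.sqrt n = 0 :=
    Finset.sum_eq_zero fun n hn ↦ by
      have hn' : n ≤ 1 := by have := Finset.mem_range.1 hn; omega
      interval_cases n <;> simp
  rw [h0, mul_zero, sub_zero] at h
  exact h

end Summit.RiemannHypothesis.RiemannHypothesis.Theorems.PolarPerronFrobenius
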